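import Mathlib

/-!
# Limits of strict factorisations (compactness lemma)

Support file for crux `ConvexGateBlind` (stmt-PneNP-10680), open stub `stub_exactLifting` (prover seat 0, session 28,
memo ANALYSIS13 §2). The currency of the stub is the STRICT rank `f(ε) = rk₊(M − εJ)` as `ε → 0⁺`. The elementary
but indispensable bridge between the algebra of the UNshifted matrix and the strict problem is lower semicontinuity:
if `M − ε_n J = ∑_{i ∈ ι} u_i^{(n)} ⊗ v_i^{(n)}` with non-negative factors along a sequence of shifts `ε_n → 0`, then —
after the invisible renormalisation `u ↦ u·s`, `v ↦ v/s` of each rank-one term, which makes the factors bounded — a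
subsequence converges, and the limit is a non-negative factorisation of `M` ITSELF with the same index set, the
rank-one TERMS `u_i^{(n)}(x) v_i^{(n)}(w)` converging to the limit terms (`exists_limit_nmf`). Consequences: `f(0⁺) ≥ rk₊(M)`,
and every ISOLATION theorem for the minimal factorisations of `M` (such as Theorem B for the line factorisation of the
triangle matrix, `…TriangleIsolation`) becomes an ε-UNIFORM jump `f(0⁺) ≥ rk₊(M) + 1` as soon as the minimal factorisation
is unique (`…TriangleJump`). Pure compactness (Bolzano–Weierstrass in a finite product of real lines); any finite index
types, any real matrix `m`.
-/

set_option linter.dupNamespace false -- `Summit.PneNP.PneNP.…`: summit = sub-problem (D-0017)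

namespace Summit.PneNP.PneNP.Theorems.XorDoor

open Filter Topology Finset

/-- **Limits of strict factorisations are factorisations of the unshifted matrix.** If for every `n` the matrix
`(m x w − ε n)` has a non-negative factorisation `∑_i u n i x * v n i w` indexed by the fixed finite type `ι`, and
`ε n → 0`, then there are non-negative `u₀, v₀` with `∑_i u₀ i x * v₀ i w = m x w` and a subsequence `φ` along which
every rank-one term converges: `u (φ n) i x * v (φ n) i w → u₀ i x * v₀ i w`. -/
theorem exists_limit_nmf {ι X W : Type} [Fintype ι] [Fintype X] [Fintype W]
    (m : X → W → ℝ) (ε : ℕ → ℝ) (hε : Tendsto ε atTop (𝓝 0))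
    (u : ℕ → ι → X → ℝ) (v : ℕ → ι → W → ℝ)
    (hu : ∀ n i x, 0 ≤ u n i x) (hv : ∀ n i w, 0 ≤ v n i w)
    (hf : ∀ n x w, ∑ i, u n i x * v n i w = m x w - ε n) :
    ∃ (u₀ : ι → X → ℝ) (v₀ : ι → W → ℝ), (∀ i x, 0 ≤ u₀ i x) ∧ (∀ i w, 0 ≤ v₀ i w) ∧
      (∀ x w, ∑ i, u₀ i x * v₀ i w = m x w) ∧
      ∃ φ : ℕ → ℕ, StrictMono φ ∧
        ∀ i x w, Tendsto (fun n => u (φ n) i x * v (φ n) i w) atTop (𝓝 (u₀ i x * v₀ i w)) := by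
  classical
  -- a uniform bound on the shifts
  obtain ⟨C, hC⟩ : ∃ C, ∀ n, |ε n| ≤ C := by
    obtain ⟨C, hC⟩ := isBounded_iff_forall_norm_le.1 (Metric.isBounded_range_of_tendsto ε hε)
    exact ⟨C, fun n => by simpa [Real.norm_eq_abs] using hC (ε n) (Set.mem_range_self n)⟩
  -- renormalisation of every rank-one term: column factor of total mass one (or zero)
  set s : ℕ → ι → ℝ := fun n i => ∑ w, v n i w with hs
  have hs0 : ∀ n i, 0 ≤ s n i := fun n i => sum_nonneg fun w _ => hv n i w
  set vh : ℕ → ι → W → ℝ := fun n i w => if s n i = 0 then 0 else v n i w / s n i with hvh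
  set uh : ℕ → ι → X → ℝ := fun n i x => u n i x * s n i with huh
  have hprod : ∀ n i x w, uh n i x * vh n i w = u n i x * v n i w := by
    intro n i x w
    simp only [huh, hvh]
    split_ifs with h
    · -- the column factor vanishes identically
      have : v n i w = 0 := by
        have := (sum_eq_zero_iff_of_nonneg (fun w _ => hv n i w)).1 h w (mem_univ _)
        exact this
      rw [this]; ring
    · field_simp
  have hvh0 : ∀ n i w, 0 ≤ vh n i w := by
    intro n i w; simp only [hvh]; split_ifs with h
    · exact le_rfl
    · exact div_nonneg (hv n i w) (hs0 n i)
  have hvh1 : ∀ n i w, vh n i w ≤ 1 := by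
    intro n i w; simp only [hvh]; split_ifs with h
    · exact zero_le_one
    · rw [div_le_one (lt_of_le_of_ne (hs0 n i) (Ne.symm h))]
      exact single_le_sum (fun w' _ => hv n i w') (mem_univ w)
  have hsumvh : ∀ n i, s n i ≠ 0 → ∑ w, vh n i w = 1 := by
    intro n i h
    simp only [hvh, if_neg h, ← sum_div]
    exact div_self h
  have huh0 : ∀ n i x, 0 ≤ uh n i x := fun n i x => mul_nonneg (hu n i x) (hs0 n i)
  -- the bound on the row factors
  set B : ℝ := ∑ x, ∑ w, |m x w| + (Fintype.card W : ℝ) * C with hB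
  have huhB : ∀ n i x, uh n i x ≤ B := by
    intro n i x
    by_cases h : s n i = 0
    · have : uh n i x = 0 := by simp only [huh, h, mul_zero]
      rw [this, hB]
      refine add_nonneg (sum_nonneg fun x _ => sum_nonneg fun w _ => abs_nonneg _) ?_
      exact mul_nonneg (Nat.cast_nonneg _) ((abs_nonneg _).trans (hC 0))
    · calc uh n i x = uh n i x * ∑ w, vh n i w := by rw [hsumvh n i h, mul_one]
        _ = ∑ w, u n i x * v n i w := by rw [mul_sum]; exact sum_congr rfl fun w _ => hprod n i x w
        _ ≤ ∑ w, ∑ j, u n j x * v n j w :=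
            sum_le_sum fun w _ => single_le_sum (f := fun j => u n j x * v n j w)
              (fun j _ => mul_nonneg (hu n j x) (hv n j w)) (mem_univ i)
        _ = ∑ w, (m x w - ε n) := sum_congr rfl fun w _ => hf n x w
        _ ≤ ∑ w, (|m x w| + C) := sum_le_sum fun w _ => by
            have h1 := le_abs_self (m x w)
            have h2 := neg_abs_le (ε n)
            linarith [hC n]
        _ = ∑ w, |m x w| + (Fintype.card W : ℝ) * C := by
            rw [sum_add_distrib, sum_const, card_univ, nsmul_eq_mul]
        _ ≤ B := by
            rw [hB]
            exact add_le_add (single_le_sum (f := fun x => ∑ w, |m x w|)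
              (fun x _ => sum_nonneg fun w _ => abs_nonneg _) (mem_univ x)) le_rfl
  -- the compact box and the sequence in it
  set K : Set ((ι → X → ℝ) × (ι → W → ℝ)) :=
    (Set.univ.pi fun _ : ι => Set.univ.pi fun _ : X => Set.Icc (0 : ℝ) B) ×ˢ
      (Set.univ.pi fun _ : ι => Set.univ.pi fun _ : W => Set.Icc (0 : ℝ) 1) with hK
  have hKc : IsCompact K := by
    refine IsCompact.prod ?_ ?_
    · exact isCompact_univ_pi fun _ => isCompact_univ_pi fun _ => isCompact_Icc
    · exact isCompact_univ_pi fun _ => isCompact_univ_pi fun _ => isCompact_Icc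
  set z : ℕ → (ι → X → ℝ) × (ι → W → ℝ) := fun n => (uh n, vh n) with hz
  have hzK : ∀ n, z n ∈ K := by
    intro n
    simp only [hz, hK, Set.mem_prod, Set.mem_univ_pi, Set.mem_Icc]
    exact ⟨fun i x => ⟨huh0 n i x, huhB n i x⟩, fun i w => ⟨hvh0 n i w, hvh1 n i w⟩⟩
  obtain ⟨a, haK, φ, hφ, hlim⟩ := hKc.tendsto_subseq hzK
  -- pointwise convergence of the factors along the subsequence
  have hlim1 : ∀ i x, Tendsto (fun n => uh (φ n) i x) atTop (𝓝 (a.1 i x)) := by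
    intro i x
    have h1 : Tendsto (fun n => (z (φ n)).1) atTop (𝓝 a.1) := (continuous_fst.tendsto a).comp hlim
    have h2 := (tendsto_pi_nhds.1 h1) i
    exact (tendsto_pi_nhds.1 h2) x
  have hlim2 : ∀ i w, Tendsto (fun n => vh (φ n) i w) atTop (𝓝 (a.2 i w)) := by
    intro i w
    have h1 : Tendsto (fun n => (z (φ n)).2) atTop (𝓝 a.2) := (continuous_snd.tendsto a).comp hlim
    have h2 := (tendsto_pi_nhds.1 h1) i
    exact (tendsto_pi_nhds.1 h2) w
  have haK' : (∀ i x, a.1 i x ∈ Set.Icc (0 : ℝ) B) ∧ ∀ i w, a.2 i w ∈ Set.Icc (0 : ℝ) 1 := by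
    simp only [hK, Set.mem_prod, Set.mem_univ_pi] at haK
    exact haK
  -- convergence of the rank-one terms
  have hterm : ∀ i x w, Tendsto (fun n => u (φ n) i x * v (φ n) i w) atTop (𝓝 (a.1 i x * a.2 i w)) := by
    intro i x w
    have := (hlim1 i x).mul (hlim2 i w)
    refine this.congr fun n => ?_
    exact hprod (φ n) i x w
  refine ⟨a.1, a.2, fun i x => (haK'.1 i x).1, fun i w => (haK'.2 i w).1, ?_, φ, hφ, hterm⟩
  -- the limit identity
  intro x w
  have hsum : Tendsto (fun n => ∑ i, u (φ n) i x * v (φ n) i w) atTop (𝓝 (∑ i, a.1 i x * a.2 i w)) :=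
    tendsto_finsetSum _ fun i _ => hterm i x w
  have hsum' : Tendsto (fun n => ∑ i, u (φ n) i x * v (φ n) i w) atTop (𝓝 (m x w)) := by
    have h1 : Tendsto (fun n => m x w - ε (φ n)) atTop (𝓝 (m x w - 0)) :=
      tendsto_const_nhds.sub (hε.comp hφ.tendsto_atTop)
    rw [sub_zero] at h1
    exact h1.congr fun n => (hf (φ n) x w).symm
  exact tendsto_nhds_unique hsum hsum'

/-- **Limits of strict factorisations, registered form** (sub-goal `strict_limit_nmf` of stmt-PneNP-10680, verbatim
signature; Mathlib vocabulary only): for any real matrix `m` on finite index types and non-negative factorisations of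
`m − ε_n` with a fixed finite index type along shifts `ε_n → 0`, some subsequence converges term by term to a
non-negative factorisation of `m`. -/
theorem strict_limit_nmf : ∀ (ι X W : Type) [Fintype ι] [Fintype X] [Fintype W] (m : X → W → ℝ) (ε : ℕ → ℝ),
    Filter.Tendsto ε Filter.atTop (nhds 0) → ∀ (u : ℕ → ι → X → ℝ) (v : ℕ → ι → W → ℝ), (∀ n i x, 0 ≤ u n i x) →
    (∀ n i w, 0 ≤ v n i w) → (∀ n x w, ∑ i, u n i x * v n i w = m x w - ε n) → ∃ (u₀ : ι → X → ℝ) (v₀ : ι → W → ℝ),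
    (∀ i x, 0 ≤ u₀ i x) ∧ (∀ i w, 0 ≤ v₀ i w) ∧ (∀ x w, ∑ i, u₀ i x * v₀ i w = m x w) ∧ ∃ φ : ℕ → ℕ, StrictMono φ ∧
    ∀ i x w, Filter.Tendsto (fun n => u (φ n) i x * v (φ n) i w) Filter.atTop (nhds (u₀ i x * v₀ i w)) :=
  fun _ _ _ _ _ _ m ε hε u v hu hv hf => exists_limit_nmf m ε hε u v hu hv hf

end Summit.PneNP.PneNP.Theorems.XorDoor
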